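import Summits.KontsevichZagierPeriods.KontsevichZagierPeriods.Theorems.ValuedFieldSpecialisationCTConstructionBlowupNilpotence
import Summits.KontsevichZagierPeriods.KontsevichZagierPeriods.Theorems.ValuedFieldSpecialisationCTConstructionBlowupPower
import Summits.KontsevichZagierPeriods.KontsevichZagierPeriods.Theorems.ValuedFieldSpecialisationCTConstructionBlowupExists
import Summits.KontsevichZagierPeriods.KontsevichZagierPeriods.Theorems.ValuedFieldSpecialisationCTConstructionPowerOnlyReduction
import Summits.KontsevichZagierPeriods.KontsevichZagierPeriods.Theorems.ValuedFieldSpecialisationCTConstructionElementaryDegenerate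
import Summits.KontsevichZagierPeriods.KontsevichZagierPeriods.Theorems.ValuedFieldSpecialisationCTConstructionEtaBoxSpecialFibre

/-!
# Route ValuedFieldSpecialisation — crux `CTConstruction`: the class core from PURE alone (log phase by blow-up elimination)

Helper toward crux stmt-KontsevichZagierPeriods-3495 (`CTConstruction`), line `registered`, RESHAPE r4:
the class core `stub_specialFibreRigidityOfEval` of the registered skeleton — "an elementary-divergent
combination `D` plus a dominated combination `G` lying in the fibred relations has special-fibre class
`y ∈ KZ.relations`" — follows from the SINGLE kernel statement PURE (`stub_pureSpecialFibreRigidity`: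
fibred relations among dominated families specialise). Cycle 3 needed in addition `log 2`-cancellation,
which entered through the dilation `Θ` of the log step; here the log step is done with the weighted
BLOW-UP `β` of the parameter (`…BlowupExists/Map/Shear/Dominated/Recast/Split/Expansion/Sorted/FibreRep`,
assembled in `…BlowupBinomial/Plumbing/Nilpotence/Power`), whose structure constants are rational.

Proof (`logPhase`, induction on the number of pure-log generators with non-zero coefficient): write
`D = Σ mᵢ [Pᵢ]`; degenerate generators (`qᵢ ≤ pᵢ`) are fibred relations (`stub_elementary_degenerate`) and
are dropped. If no pure-log generator is left, the POWER-ONLY reduction of cycle 3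
(`stub_powerOnly_reduction`) concludes. Otherwise let `b*` be the top log level and apply `T^[b*]`,
`T = 2β − 1`, to the relation `D + G`: power generators stay in the power subgroup (`blowupT_iterate_pow`),
pure-log generators of level `< b*` die and those of level `b*` become `(2^{b*} b*!) •` CONSTANT families over
representations `Wᵢ` with `4^{b*} • [Wᵢ] ≡ [rᵢ]` (`blowupT_iterate_log`), and the dominated part keeps a
dominated presentation with special fibre in `relations` (`blowupT_iterate_closure_dominatedPairs`).
Constant families are dominated with special fibre `≡ Wᵢ` (`stub_etaBox_specialFibre` with an empty block),
so the power-only reduction gives `Σ_top mᵢ (2^{b*} b*!) • [Wᵢ] ∈ relations`, whence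
`Z = Σ_top mᵢ [rᵢ] ∈ relations` (torsion-freeness, `mem_relations_of_nsmul_mem`); then the top log terms
`Σ_top mᵢ [Pᵢ] ≡ [M_{0,b*}] * Z` are a fibred relation (`of_elementary_sub_of_prod_mem_fibredRelations`,
`stub_productFibred`), are peeled off, and the induction hypothesis applies. Main statement:
`coreReduction_of_pure`, registered as `stub_coreReduction_of_pure`.

Sources: M. Kontsevich, D. Zagier, *Periods* (2001), §1.2; the encoding and the blow-up calculus are this
route's. No new definitions.
-/

noncomputable section

namespace Summit.KontsevichZagierPeriods.ValuedFieldSpecialisation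

open MeasureTheory Set Filter
open scoped Topology
open Literature.NumberTheory.Transcendental Literature.NumberTheory.Transcendental.KZ
open Summit.KontsevichZagierPeriods.MzvKernelInKZ.Negative (mem_relations_of_nsmul_mem)

/-- **A constant family over `W` is a dominated pair with special fibre `≡ [W]`**: the elementary product
with empty block and `p = 0` over `W` is dominated by some `V.abs` with special fibre `V`, and
`[V] − [W] ∈ KZ.relations` (`stub_etaBox_specialFibre` with `B = 0`; the `0`-dimensional box is the unit
representation, `KZ.of_unit_mul_sub_mem_relations`). [folklore] -/
theorem constantFamily_dominatedPair {q d : ℕ} (hq : 0 < q) (W : IntegralRep d) (C : IntegralRep (0 + d + 1 + 1))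
    (hCd : C.domain = {z | ∃ (s u : ℝ) (y : Fin 0 → ℝ) (w : Fin d → ℝ),
      z = Matrix.vecCons s (Matrix.vecCons u (Fin.append y w)) ∧ 0 < s ∧ s < 1 ∧ 0 < u ∧
        u ^ q * s ^ 0 < 1 ∧ (∀ j, s ≤ y j ∧ y j ≤ 1) ∧ w ∈ W.domain})
    (hCi : C.integrand = fun z => (∏ j : Fin 0, (z (Fin.castAdd d j).succ.succ)⁻¹) *
      W.integrand (fun l : Fin d => z (Fin.natAdd 0 l).succ.succ)) :
    ∃ V : IntegralRep (0 + d + 1), IsDominatedFamily C V V.abs ∧ of V - of W ∈ relations := by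
  have hCd' : C.domain = {z | ∃ (s u : ℝ) (t : Fin 0 → ℝ) (w : Fin d → ℝ),
      z = Matrix.vecCons s (Matrix.vecCons u (Fin.append t w)) ∧ 0 < s ∧ s < 1 ∧ 0 < u ∧
        u ^ q * s ^ 0 < 1 ∧ (∀ j, (((fun _ : Fin 0 => (1 : ℚ)) j : ℚ) : ℝ) * s ^ ((fun _ : Fin 0 => 0) j) ≤ t j ∧
          t j ≤ 1) ∧ w ∈ W.domain} := by
    rw [hCd]
    ext z
    constructor
    · rintro ⟨s, u, y, w, h1, h2, h3, h4, h5, -, h7⟩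
      exact ⟨s, u, y, w, h1, h2, h3, h4, h5, fun j => j.elim0, h7⟩
    · rintro ⟨s, u, y, w, h1, h2, h3, h4, h5, -, h7⟩
      exact ⟨s, u, y, w, h1, h2, h3, h4, h5, fun j => j.elim0, h7⟩
  obtain ⟨V, Lb, hdom, hLbd, hLbi, hrel⟩ := stub_etaBox_specialFibre q 0 0 d 1 (fun _ => 1) (fun _ => 0) W C
    hq rfl one_pos le_rfl (fun _ => rfl) (fun _ => rfl) hCd' hCi
  have hLb : Lb = IntegralRep.unit := by
    refine IntegralRep.ext' ?_ ?_
    · rw [hLbd, IntegralRep.unit_domain]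
      exact Set.eq_univ_of_forall fun t j => j.elim0
    · rw [hLbi, IntegralRep.unit_integrand]
      funext t
      simp
  refine ⟨V, hdom, ?_⟩
  rw [hLb] at hrel
  have := relations.add_mem hrel (of_unit_mul_sub_mem_relations (of W))
  convert this using 1
  abel

section LogPhase

variable (hPURE : ∀ (G y : Literature.NumberTheory.Transcendental.KZ.FormalRep), (G, y) ∈ AddSubgroup.closure {v : Literature.NumberTheory.Transcendental.KZ.FormalRep × Literature.NumberTheory.Transcendental.KZ.FormalRep | ∃ (n : ℕ) (S : Literature.NumberTheory.Transcendental.KZ.IntegralRep (n + 1)) (r₀ g : Literature.NumberTheory.Transcendental.KZ.IntegralRep n), Literature.NumberTheory.Transcendental.KZ.IsDominatedFamily S r₀ g ∧ v = (Literature.NumberTheory.Transcendental.KZ.of S, Literature.NumberTheory.Transcendental.KZ.of r₀)} → G ∈ Literature.NumberTheory.Transcendental.KZ.fibredRelations → y ∈ Literature.NumberTheory.Transcendental.KZ.relations)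
  {Tβ : (Σ n, IntegralRep n) → FormalRep}
  (hT0 : ∀ ρ : IntegralRep 0, Tβ ⟨0, ρ⟩ = 0)
  (hT : ∀ (n : ℕ) (ρ : IntegralRep (n + 1)), ∃ ρ' : IntegralRep (n + 1 + 1), Tβ ⟨n + 1, ρ⟩ = of ρ' ∧
    ρ'.domain = {z | 0 < z 1 ∧ z 1 < z 0 ∧ z 0 < 1 ∧ (fun i : Fin (n + 1) => z i.succ) ∈ ρ.domain} ∧
    ρ'.integrand = fun z => z 1 / z 0 ^ 2 * ρ.integrand (fun i : Fin (n + 1) => z i.succ))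
  {k : ℕ} {p q b d : Fin k → ℕ} {r : (i : Fin k) → IntegralRep (d i)}
  {P : (i : Fin k) → IntegralRep (b i + d i + 1 + 1)}
  (hP : ∀ i, 0 < q i ∧ (0 < p i ∨ 0 < b i) ∧
    (P i).domain = {z | ∃ (s u : ℝ) (y : Fin (b i) → ℝ) (w : Fin (d i) → ℝ),
      z = Matrix.vecCons s (Matrix.vecCons u (Fin.append y w)) ∧ 0 < s ∧ s < 1 ∧ 0 < u ∧
        u ^ (q i) * s ^ (p i) < 1 ∧ (∀ j, s ≤ y j ∧ y j ≤ 1) ∧ w ∈ (r i).domain} ∧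
    (P i).integrand = fun z => (∏ j : Fin (b i), (z (Fin.castAdd (d i) j).succ.succ)⁻¹) *
      (r i).integrand (fun l : Fin (d i) => z (Fin.natAdd (b i) l).succ.succ))

include hPURE hT0 hT hP in
/-- **The log phase** (see the module docstring): induction on the number of pure-log generators with a
non-zero coefficient. [folklore] -/
theorem logPhase : ∀ (N : ℕ) (c : Fin k → ℤ), (∀ i, c i ≠ 0 → p i < q i) →
    (Finset.univ.filter fun i => p i = 0 ∧ c i ≠ 0).card ≤ N →
    ∀ (G y : FormalRep), (G, y) ∈ AddSubgroup.closure {v : Literature.NumberTheory.Transcendental.KZ.FormalRep × Literature.NumberTheory.Transcendental.KZ.FormalRep | ∃ (n : ℕ) (S : Literature.NumberTheory.Transcendental.KZ.IntegralRep (n + 1)) (r₀ g : Literature.NumberTheory.Transcendental.KZ.IntegralRep n), Literature.NumberTheory.Transcendental.KZ.IsDominatedFamily S r₀ g ∧ v = (Literature.NumberTheory.Transcendental.KZ.of S, Literature.NumberTheory.Transcendental.KZ.of r₀)} →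
      (∑ i, c i • of (P i)) + G ∈ fibredRelations → y ∈ relations := by
  classical
  intro N
  induction N with
  | zero =>
    intro c hc hN G y hGy hF
    -- no pure-log generator: power-only reduction
    rw [Nat.le_zero, Finset.card_eq_zero, Finset.filter_eq_empty_iff] at hN
    refine stub_powerOnly_reduction hPURE _ ?_ G y hGy hF
    refine AddSubgroup.sum_mem _ fun i _ => ?_
    by_cases hci : c i = 0
    · rw [hci, zero_smul]; exact AddSubgroup.zero_mem _
    · have hpi : 0 < p i := Nat.pos_of_ne_zero fun h => hN (Finset.mem_univ i) ⟨h, hci⟩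
      refine AddSubgroup.zsmul_mem _ (AddSubgroup.subset_closure ?_) _
      exact ⟨p i, q i, b i, d i, r i, P i, (hP i).1, hpi, (hP i).2.2.1, (hP i).2.2.2, rfl⟩
  | succ N ih =>
    intro c hc hN G y hGy hF
    set L := Finset.univ.filter fun i => p i = 0 ∧ c i ≠ 0 with hL
    by_cases hLe : L = ∅
    · exact ih c hc (by rw [← hL, hLe, Finset.card_empty]; exact Nat.zero_le _) G y hGy hF
    -- the top log level `bs` and the top set
    obtain ⟨i₀, hi₀, hmax⟩ := Finset.exists_max_image L b (Finset.nonempty_iff_ne_empty.mpr hLe)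
    have hi₀' : p i₀ = 0 ∧ c i₀ ≠ 0 := (Finset.mem_filter.mp hi₀).2
    set bs := b i₀ with hbs
    have hbs_pos : 0 < bs := ((hP i₀).2.1.resolve_left (by omega))
    set top := Finset.univ.filter fun i => p i = 0 ∧ b i = bs ∧ c i ≠ 0 with htop
    have htop_mem : ∀ i, i ∈ top ↔ p i = 0 ∧ b i = bs ∧ c i ≠ 0 := fun i => by simp [htop]
    have hlow : ∀ i, p i = 0 → c i ≠ 0 → i ∉ top → b i < bs := by
      intro i hpi hci hit
      have hle := hmax i (Finset.mem_filter.mpr ⟨Finset.mem_univ _, hpi, hci⟩)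
      exact lt_of_le_of_ne hle fun h => hit ((htop_mem i).mpr ⟨hpi, h, hci⟩)
    -- notation for `T`
    set F : FormalRep → FormalRep := fun x => 2 • FreeAbelianGroup.lift Tβ x - x with hFdef
    -- (a) the non-top terms land in the power subgroup modulo fibred relations
    have hrest : ∀ i, i ∉ top → ∃ x' ∈ AddSubgroup.closure {x : Literature.NumberTheory.Transcendental.KZ.FormalRep | ∃ (p q b d : ℕ) (r : Literature.NumberTheory.Transcendental.KZ.IntegralRep d) (P : Literature.NumberTheory.Transcendental.KZ.IntegralRep (b + d + 1 + 1)), 0 < p ∧ p < q ∧ P.domain = {z | ∃ (s u : ℝ) (y : Fin b → ℝ) (w : Fin d → ℝ), z = Matrix.vecCons s (Matrix.vecCons u (Fin.append y w)) ∧ 0 < s ∧ s < 1 ∧ 0 < u ∧ u ^ q * s ^ p < 1 ∧ (∀ j, s ≤ y j ∧ y j ≤ 1) ∧ w ∈ r.domain} ∧ P.integrand = (fun z => (∏ j : Fin b, (z (Fin.castAdd d j).succ.succ)⁻¹) * r.integrand (fun l : Fin d => z (Fin.natAdd b l).succ.succ)) ∧ x = Literature.NumberTheory.Transcendental.KZ.of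 P},
        c i • F^[bs] (of (P i)) - x' ∈ fibredRelations := by
      intro i hit
      by_cases hci : c i = 0
      · exact ⟨0, AddSubgroup.zero_mem _, by simp [hci, fibredRelations.zero_mem]⟩
      by_cases hpi : p i = 0
      · -- a pure-log generator below the top level dies
        refine ⟨0, AddSubgroup.zero_mem _, ?_⟩
        rw [sub_zero]
        refine fibredRelations.zsmul_mem ?_ _
        have hdom := (hP i).2.2.1
        simp only [hpi] at hdom
        exact (blowupT_iterate_log hT0 hT bs).1 (b i) (q i) (d i) (r i) (P i) (hlow i hpi hci hit) (hP i).1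
          hdom (hP i).2.2.2
      · -- a power generator stays in the power subgroup
        obtain ⟨x', hx', hrel⟩ := blowupT_iterate_pow hT0 hT bs (of (P i)) (AddSubgroup.subset_closure
          ⟨p i, q i, b i, d i, r i, P i, Nat.pos_of_ne_zero hpi, hc i hci, (hP i).2.2.1, (hP i).2.2.2, rfl⟩)
        exact ⟨c i • x', AddSubgroup.zsmul_mem _ hx' _, by rw [← smul_sub]; exact fibredRelations.zsmul_mem hrel _⟩
    choose! xr hxr hxr' using hrest
    -- (b) the top terms become constant families
    have htopC : ∀ i, ∃ (d' : ℕ) (W : IntegralRep d') (C : IntegralRep (0 + d' + 1 + 1)), i ∈ top →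
        C.domain = {z | ∃ (s u : ℝ) (y : Fin 0 → ℝ) (w : Fin d' → ℝ),
          z = Matrix.vecCons s (Matrix.vecCons u (Fin.append y w)) ∧ 0 < s ∧ s < 1 ∧ 0 < u ∧
            u ^ (q i) * s ^ 0 < 1 ∧ (∀ j, s ≤ y j ∧ y j ≤ 1) ∧ w ∈ W.domain} ∧
        C.integrand = (fun z => (∏ j : Fin 0, (z (Fin.castAdd d' j).succ.succ)⁻¹) *
          W.integrand (fun l : Fin d' => z (Fin.natAdd 0 l).succ.succ)) ∧
        F^[bs] (of (P i)) - (2 ^ bs * bs.factorial) • of C ∈ fibredRelations ∧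
        4 ^ bs • of W - of (r i) ∈ relations := by
      intro i
      by_cases hit : i ∈ top
      · obtain ⟨hpi, hbi, -⟩ := (htop_mem i).mp hit
        have hdom := (hP i).2.2.1
        simp only [hpi] at hdom
        obtain ⟨d', W, C, hCd, hCi, hC, hW⟩ := (blowupT_iterate_log hT0 hT bs).2 (b i) (q i) (d i) (r i) (P i)
          hbi (hP i).1 hdom (hP i).2.2.2
        exact ⟨d', W, C, fun _ => ⟨hCd, hCi, hC, hW⟩⟩
      · exact ⟨0, IntegralRep.unit, (IntegralRep.unit.cylinder).cylinder, fun h => absurd h hit⟩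
    choose dW Wf Cf hCf using htopC
    have hCV : ∀ i, ∃ V : IntegralRep (0 + dW i + 1), i ∈ top →
        IsDominatedFamily (Cf i) V V.abs ∧ of V - of (Wf i) ∈ relations := by
      intro i
      by_cases hit : i ∈ top
      · obtain ⟨V, hV, hV'⟩ := constantFamily_dominatedPair (hP i).1 (Wf i) (Cf i) (hCf i hit).1 (hCf i hit).2.1
        exact ⟨V, fun _ => ⟨hV, hV'⟩⟩
      · exact ⟨cast (congrArg IntegralRep (by omega)) (Wf i).cylinder, fun h => absurd h hit⟩
    choose V hV using hCV
    -- (c) the dominated part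
    obtain ⟨G', y', hG', hGy', hy'⟩ := blowupT_iterate_closure_dominatedPairs hT0 hT bs hbs_pos hGy
    -- the transformed relation
    set Nn : ℕ := 2 ^ bs * bs.factorial with hNn
    have hNn_pos : 0 < Nn := by positivity
    set X : FormalRep := ∑ i ∈ Finset.univ.filter (fun i => i ∉ top), xr i with hX
    set Ctot : FormalRep := ∑ i ∈ top, (c i * Nn) • of (Cf i) with hCtot
    set Vtot : FormalRep := ∑ i ∈ top, (c i * Nn) • of (V i) with hVtot
    have hX_mem : X ∈ AddSubgroup.closure {x : Literature.NumberTheory.Transcendental.KZ.FormalRep | ∃ (p q b d : ℕ) (r : Literature.NumberTheory.Transcendental.KZ.IntegralRep d) (P : Literature.NumberTheory.Transcendental.KZ.IntegralRep (b + d + 1 + 1)), 0 < p ∧ p < q ∧ P.domain = {z | ∃ (s u : ℝ) (y : Fin b → ℝ) (w : Fin d → ℝ), z = Matrix.vecCons s (Matrix.vecCons u (Fin.append y w)) ∧ 0 < s ∧ s < 1 ∧ 0 < u ∧ u ^ q * s ^ p < 1 ∧ (∀ j, s ≤ y j ∧ y j ≤ 1) ∧ w ∈ r.domain} ∧ P.integrand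 = (fun z => (∏ j : Fin b, (z (Fin.castAdd d j).succ.succ)⁻¹) * r.integrand (fun l : Fin d => z (Fin.natAdd b l).succ.succ)) ∧ x = Literature.NumberTheory.Transcendental.KZ.of P} :=
      AddSubgroup.sum_mem _ fun i hi => hxr i (Finset.mem_filter.mp hi).2
    have hF_all : F^[bs] ((∑ i, c i • of (P i)) + G) ∈ fibredRelations :=
      blowupT_iterate_mem_fibredRelations hT0 hT bs hF
    have hF_exp : F^[bs] ((∑ i, c i • of (P i)) + G) =
        (∑ i ∈ Finset.univ.filter (fun i => i ∉ top), c i • F^[bs] (of (P i))) +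
          (∑ i ∈ top, c i • F^[bs] (of (P i))) + F^[bs] G := by
      rw [blowupT_iterate_map_add, blowupT_iterate_map_sum]
      simp only [blowupT_iterate_map_zsmul]
      rw [← Finset.sum_filter_add_sum_filter_not Finset.univ (fun i => i ∈ top)]
      have : Finset.univ.filter (fun i => i ∈ top) = top := by ext i; simp
      rw [this]
      abel
    have hrel1 : (∑ i ∈ Finset.univ.filter (fun i => i ∉ top), c i • F^[bs] (of (P i))) - X ∈ fibredRelations := by
      rw [hX, ← Finset.sum_sub_distrib]
      exact fibredRelations.sum_mem fun i hi => hxr' i (Finset.mem_filter.mp hi).2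
    have hrel2 : (∑ i ∈ top, c i • F^[bs] (of (P i))) - Ctot ∈ fibredRelations := by
      rw [hCtot, ← Finset.sum_sub_distrib]
      refine fibredRelations.sum_mem fun i hi => ?_
      have h := fibredRelations.zsmul_mem (hCf i hi).2.2.1 (c i)
      rw [smul_sub] at h
      convert h using 2
      rw [mul_smul, natCast_zsmul]
    have hmain : X + (Ctot + G') ∈ fibredRelations := by
      have h := fibredRelations.sub_mem (fibredRelations.sub_mem (fibredRelations.sub_mem hF_all hrel1) hrel2) hG'
      rw [hF_exp] at h
      convert h using 1
      abel
    -- the dominated presentation of `Ctot + G'`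
    have hpair : (Ctot + G', Vtot + y') ∈ AddSubgroup.closure {v : Literature.NumberTheory.Transcendental.KZ.FormalRep × Literature.NumberTheory.Transcendental.KZ.FormalRep | ∃ (n : ℕ) (S : Literature.NumberTheory.Transcendental.KZ.IntegralRep (n + 1)) (r₀ g : Literature.NumberTheory.Transcendental.KZ.IntegralRep n), Literature.NumberTheory.Transcendental.KZ.IsDominatedFamily S r₀ g ∧ v = (Literature.NumberTheory.Transcendental.KZ.of S, Literature.NumberTheory.Transcendental.KZ.of r₀)} := by
      rw [← Prod.mk_add_mk]
      refine AddSubgroup.add_mem _ ?_ hGy'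
      have : (Ctot, Vtot) = ∑ i ∈ top, (c i * Nn) • (of (Cf i), of (V i)) := by
        rw [hCtot, hVtot]; ext <;> simp [Prod.fst_sum, Prod.snd_sum]
      rw [this]
      refine AddSubgroup.sum_mem _ fun i hi => AddSubgroup.zsmul_mem _ (AddSubgroup.subset_closure ?_) _
      exact ⟨_, Cf i, V i, (V i).abs, (hV i hi).1, rfl⟩
    -- power-only reduction: the special fibre is a relation
    have hVrel : Vtot ∈ relations := by
      have h := stub_powerOnly_reduction hPURE X (closure_powLt_le_closure_pow hX_mem) _ _ hpair hmain
      have := relations.sub_mem h hy'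
      rwa [add_sub_cancel_right] at this
    -- hence `Nn • Z ∈ relations`, `Z = Σ_top c i • [r i]`
    have hZ : (∑ i ∈ top, c i • of (r i)) ∈ relations := by
      have h1 : Vtot - ∑ i ∈ top, (c i * Nn) • of (Wf i) ∈ relations := by
        rw [hVtot, ← Finset.sum_sub_distrib]
        exact relations.sum_mem fun i hi => by
          rw [← smul_sub]; exact relations.zsmul_mem (hV i hi).2 _
      have h2 : (4 ^ bs) • (∑ i ∈ top, (c i * Nn) • of (Wf i)) - ∑ i ∈ top, (c i * Nn) • of (r i) ∈ relations := by
        rw [Finset.smul_sum, ← Finset.sum_sub_distrib]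
        refine relations.sum_mem fun i hi => ?_
        rw [smul_comm, ← smul_sub]
        exact relations.zsmul_mem (hCf i hi).2.2.2 _
      have h3 : ∑ i ∈ top, (c i * Nn) • of (r i) ∈ relations := by
        have := relations.sub_mem (relations.nsmul_mem (relations.sub_mem hVrel h1) (4 ^ bs)) h2
        rwa [sub_sub_cancel, sub_sub_cancel] at this
      have h3' : ∑ i ∈ top, (c i * Nn) • of (r i) = Nn • ∑ i ∈ top, c i • of (r i) := by
        rw [Finset.smul_sum]
        refine Finset.sum_congr rfl fun i _ => ?_
        rw [← natCast_zsmul, smul_smul, mul_comm]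
      rw [h3'] at h3
      exact mem_relations_of_nsmul_mem hNn_pos h3
    -- peel the top log terms
    have hpeel : (∑ i ∈ top, c i • of (P i)) ∈ fibredRelations := by
      obtain ⟨M, hMd, hMi⟩ := exists_elementaryRep (p := 0) (q := 1) (b := bs) Nat.zero_lt_one IntegralRep.unit
      have h1 : ∀ i ∈ top, of (P i) - of (M.prod (r i)) ∈ fibredRelations := by
        intro i hi
        obtain ⟨hpi, hbi, -⟩ := (htop_mem i).mp hi
        refine of_elementary_sub_of_prod_mem_fibredRelations (hP i).1 Nat.zero_lt_one ?_ hbi (r i) (P i) M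
          (hP i).2.2.1 (hP i).2.2.2 hMd hMi
        simp [hpi]
      have h2 : of M * (∑ i ∈ top, c i • of (r i)) ∈ fibredRelations :=
        LiouvilleUnfolding.SpectatorLocalisation.stub_productFibred _ M (by omega) _ hZ
      have h3 : of M * (∑ i ∈ top, c i • of (r i)) = ∑ i ∈ top, c i • of (M.prod (r i)) := by
        rw [Finset.mul_sum]
        refine Finset.sum_congr rfl fun i _ => ?_
        rw [mul_smul_comm, of_mul_of]
      rw [h3] at h2
      have h4 : ∑ i ∈ top, c i • of (P i) =
          ∑ i ∈ top, c i • (of (P i) - of (M.prod (r i))) + ∑ i ∈ top, c i • of (M.prod (r i)) := by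
        rw [← Finset.sum_add_distrib]
        refine Finset.sum_congr rfl fun i _ => ?_
        rw [smul_sub, sub_add_cancel]
      rw [h4]
      exact fibredRelations.add_mem (fibredRelations.sum_mem fun i hi => fibredRelations.zsmul_mem (h1 i hi) _) h2
    -- drop the top terms and apply the induction hypothesis
    let c₁ : Fin k → ℤ := fun i => if i ∈ top then 0 else c i
    have hc₁ : ∀ i, c₁ i ≠ 0 → p i < q i := by
      intro i hi
      by_cases hit : i ∈ top
      · simp [c₁, hit] at hi
      · simp only [c₁, hit, if_false] at hi
        exact hc i hi
    have hsplit : (∑ i, c i • of (P i)) = (∑ i, c₁ i • of (P i)) + ∑ i ∈ top, c i • of (P i) := by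
      rw [← Finset.sum_filter_add_sum_filter_not Finset.univ (fun i => i ∈ top) (fun i => c i • of (P i))]
      have ht : Finset.univ.filter (fun i => i ∈ top) = top := by ext i; simp
      rw [ht, add_comm]
      congr 1
      rw [← Finset.sum_filter_add_sum_filter_not Finset.univ (fun i => i ∈ top) (fun i => c₁ i • of (P i)), ht]
      have h0 : ∑ i ∈ top, c₁ i • of (P i) = 0 := Finset.sum_eq_zero fun i hi => by simp [c₁, hi]
      rw [h0, zero_add]
      refine Finset.sum_congr rfl fun i hi => ?_
      have hit : i ∉ top := (Finset.mem_filter.mp hi).2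
      simp [c₁, hit]
    have hF₁ : (∑ i, c₁ i • of (P i)) + G ∈ fibredRelations := by
      have := fibredRelations.sub_mem hF hpeel
      rw [hsplit] at this
      convert this using 1
      abel
    have hcard : (Finset.univ.filter fun i => p i = 0 ∧ c₁ i ≠ 0).card ≤ N := by
      have hsub : (Finset.univ.filter fun i => p i = 0 ∧ c₁ i ≠ 0) ⊂ L := by
        rw [Finset.ssubset_iff_of_subset]
        · refine ⟨i₀, hi₀, fun h => ?_⟩
          have h' := (Finset.mem_filter.mp h).2.2
          have hit : i₀ ∈ top := (htop_mem i₀).mpr ⟨hi₀'.1, rfl, hi₀'.2⟩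
          simp [c₁, hit] at h'
        · intro i hi
          obtain ⟨hpi, hci⟩ := (Finset.mem_filter.mp hi).2
          refine Finset.mem_filter.mpr ⟨Finset.mem_univ _, hpi, ?_⟩
          by_cases hit : i ∈ top
          · simp [c₁, hit] at hci
          · simpa [c₁, hit] using hci
      have := Finset.card_lt_card hsub
      omega
    exact ih c₁ hc₁ hcard G y hGy hF₁

end LogPhase

/-! ## The entry theorem -/

/-- **The class core from PURE alone** (crux `CTConstruction`, line `registered`, reshape r4): see the
module docstring. The value hypothesis `eval y = 0` is not used. [folklore] -/
theorem coreReduction_of_pure : (∀ (G y : Literature.NumberTheory.Transcendental.KZ.FormalRep), (G, y) ∈ AddSubgroup.closure {v : Literature.NumberTheory.Transcendental.KZ.FormalRep × Literature.NumberTheory.Transcendental.KZ.FormalRep | ∃ (n : ℕ) (S : Literature.NumberTheory.Transcendental.KZ.IntegralRep (n + 1)) (r₀ g : Literature.NumberTheory.Transcendental.KZ.IntegralRep n), Literature.NumberTheory.Transcendental.KZ.IsDominatedFamily S r₀ g ∧ v = (Literature.NumberTheory.Transcendental.KZ.of S, Literature.NumberTheory.Transcendental.KZ.of r₀)} → G ∈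 Literature.NumberTheory.Transcendental.KZ.fibredRelations → y ∈ Literature.NumberTheory.Transcendental.KZ.relations) → ∀ D ∈ AddSubgroup.closure Summit.KontsevichZagierPeriods.ValuedFieldSpecialisation.elementaryGenerators, ∀ (G y : Literature.NumberTheory.Transcendental.KZ.FormalRep), (G, y) ∈ AddSubgroup.closure {v : Literature.NumberTheory.Transcendental.KZ.FormalRep × Literature.NumberTheory.Transcendental.KZ.FormalRep | ∃ (n : ℕ) (S : Literature.NumberTheory.Transcendental.KZ.IntegralRep (n + 1)) (r₀ g : Literature.NumberTheory.Transcendental.KZ.IntegralRep n), Literature.NumberTheory.Transcendental.KZ.IsDominatedFamily S r₀ g ∧ v = (Literature.NumberTheory.Transcendental.KZ.of S, Literature.NumberTheory.Transcendental.KZ.of r₀)} → D + G ∈ Literature.NumberTheory.Transcendental.KZ.fibredRelations → Literature.NumberTheory.Transcendental.KZ.eval y = 0 → y ∈ Literature.NumberTheory.Transcendental.KZ.relations := by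
  intro hPURE D hD G y hGy hF _heval
  classical
  obtain ⟨k, m, p, q, b, d, r, P, hP, rfl⟩ := (mem_closure_elementaryGenerators_iff D).mp hD
  -- the blow-up generator map
  have hbl : ∀ (n : ℕ) (ρ : IntegralRep (n + 1)), ∃ ρ' : IntegralRep (n + 1 + 1),
      ρ'.domain = {z | 0 < z 1 ∧ z 1 < z 0 ∧ z 0 < 1 ∧ (fun i : Fin (n + 1) => z i.succ) ∈ ρ.domain} ∧
      ρ'.integrand = fun z => z 1 / z 0 ^ 2 * ρ.integrand (fun i : Fin (n + 1) => z i.succ) :=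
    fun n ρ => stub_exists_blowup n ρ
  choose bl hbld hbli using hbl
  let Tβ : (Σ n, IntegralRep n) → FormalRep := fun x => match x with
    | ⟨0, _⟩ => 0
    | ⟨n + 1, ρ⟩ => of (bl n ρ)
  have hT0 : ∀ ρ : IntegralRep 0, Tβ ⟨0, ρ⟩ = 0 := fun _ => rfl
  have hT : ∀ (n : ℕ) (ρ : IntegralRep (n + 1)), ∃ ρ' : IntegralRep (n + 1 + 1), Tβ ⟨n + 1, ρ⟩ = of ρ' ∧
      ρ'.domain = {z | 0 < z 1 ∧ z 1 < z 0 ∧ z 0 < 1 ∧ (fun i : Fin (n + 1) => z i.succ) ∈ ρ.domain} ∧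
      ρ'.integrand = fun z => z 1 / z 0 ^ 2 * ρ.integrand (fun i : Fin (n + 1) => z i.succ) :=
    fun n ρ => ⟨bl n ρ, rfl, hbld n ρ, hbli n ρ⟩
  -- drop the degenerate generators (`q ≤ p`): they are fibred relations
  let c : Fin k → ℤ := fun i => if p i < q i then m i else 0
  have hc : ∀ i, c i ≠ 0 → p i < q i := by
    intro i hi
    by_contra h
    simp [c, h] at hi
  have hdeg : (∑ i, m i • of (P i)) - ∑ i, c i • of (P i) ∈ fibredRelations := by
    rw [← Finset.sum_sub_distrib]
    refine fibredRelations.sum_mem fun i _ => ?_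
    by_cases h : p i < q i
    · simp [c, h, fibredRelations.zero_mem]
    · simp only [c, h, if_false, zero_smul, sub_zero]
      exact fibredRelations.zsmul_mem (stub_elementary_degenerate (p i) (q i) (b i) (d i) (r i) (P i) (hP i).1
        (not_lt.mp h) (hP i).2.2.1 (hP i).2.2.2) _
  have hF' : (∑ i, c i • of (P i)) + G ∈ fibredRelations := by
    have := fibredRelations.sub_mem hF hdeg
    convert this using 1
    abel
  exact logPhase hPURE hT0 hT hP _ c hc le_rfl G y hGy hF'

/-- **Registered skeleton stub `stub_coreReduction_of_pure`** (crux `CTConstruction`, line `registered`,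
reshape r4): PURE → the class core `stub_specialFibreRigidityOfEval`, verbatim signatures. [folklore] -/
theorem stub_coreReduction_of_pure : (∀ (G y : Literature.NumberTheory.Transcendental.KZ.FormalRep), (G, y) ∈ AddSubgroup.closure {v : Literature.NumberTheory.Transcendental.KZ.FormalRep × Literature.NumberTheory.Transcendental.KZ.FormalRep | ∃ (n : ℕ) (S : Literature.NumberTheory.Transcendental.KZ.IntegralRep (n + 1)) (r₀ g : Literature.NumberTheory.Transcendental.KZ.IntegralRep n), Literature.NumberTheory.Transcendental.KZ.IsDominatedFamily S r₀ g ∧ v = (Literature.NumberTheory.Transcendental.KZ.of S, Literature.NumberTheory.Transcendental.KZ.of r₀)} → G ∈ Literature.NumberTheory.Transcendental.KZ.fibredRelations → y ∈ Literature.NumberTheory.Transcendental.KZ.relations) → ∀ D ∈ AddSubgroup.closure Summit.KontsevichZagierPeriods.ValuedFieldSpecialisation.elementaryGenerators, ∀ (G y : Literature.NumberTheory.Transcendental.KZ.FormalRep), (G, y) ∈ AddSubgroup.closure {v : Literature.NumberTheory.Transcendental.KZ.FormalRep × Literature.NumberTheory.Transcendental.KZ.FormalRep | ∃ (n : ℕ)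 (S : Literature.NumberTheory.Transcendental.KZ.IntegralRep (n + 1)) (r₀ g : Literature.NumberTheory.Transcendental.KZ.IntegralRep n), Literature.NumberTheory.Transcendental.KZ.IsDominatedFamily S r₀ g ∧ v = (Literature.NumberTheory.Transcendental.KZ.of S, Literature.NumberTheory.Transcendental.KZ.of r₀)} → D + G ∈ Literature.NumberTheory.Transcendental.KZ.fibredRelations → Literature.NumberTheory.Transcendental.KZ.eval y = 0 → y ∈ Literature.NumberTheory.Transcendental.KZ.relations :=
  coreReduction_of_pure

end Summit.KontsevichZagierPeriods.ValuedFieldSpecialisation
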